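import Summits.CriticalPhenomena.PercolationContinuityZ3.Theorems.PercNearOneGluingNoHeavyQuantTopFlippedLightFloorPoly
import HarnessLib

/-!
# QUANT lane R8, T-DEC, binder (II): the TOP-FLIPPED LIGHT PIECES WITHOUT ASPECT BOUND (floors `x ≥ 1/3`) — part 2a, the
# light–heavy capacity inequality cell by cell

builds on p205010 (kernel theorem, internal audit signed; external expert review pending)

Support file (`--supports stmt-CriticalPhenomena-4575`), QUANT lane seat prim-quant-arm-2 (gen 31).  `tfpCellF_*`: as `tfpCell_*` of
`…TopFlippedLightHeavyCells` with the aspect hypothesis replaced by the floor `x ≥ 1/3`.  Theorems only, standard axioms.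

[this work]; DEC rules ARCH-TREES-G49 §2.2 / DEC-TAMP-G50 §3.1, the single-low criterion `…QuantSingleLowCapacity` (typer g23), the
cell-certificate pipeline FOR-PROVERS-CERT-PIPELINE (typer g23), the (II) piece anatomy FOR-PROVERS-CONV-PIECES (lead g26) — this lane.
Nothing here is cited as a published result.  The gluing rows served [cite: KozmaNitzan2024, Conjecture 3 (p. 15)]; product measure
[cite: Grimmett1999, §1.3 p. 10].
-/

noncomputable section

namespace Summit.CriticalPhenomena.PercolationContinuityZ3.Theorems

namespace Quant

open Finset

namespace LawDec

set_option maxHeartbeats 4000000 in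
set_option maxRecDepth 100000 in
/-- cell `LH_LH` of the top-flipped light–heavy piece: the capacity inequality with the cell's closed forms. -/
theorem tfpCellF_LH_LH (x p q P' : ℝ) (hx0 : 0 < x) (hx1 : x < 1) (hp0 : 0 < p) (hpx : p < x) (hxq : x ≤ q) (hq1 : q ≤ 1) (hPp : p < P') (hx3 : (1:ℝ) / 3 ≤ x) (hPx : P' ≤ x) (hQ1 : q * P' < P' - p) (_hP2 : P' ≤ 2) (_hQ2 : q * P' ≤ 2 * (P' - p)) :
    x / (1 - x) * ((1 - (x ^ 2 + (1 - x) * p)) * (1 - q)) ≤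
      x / (1 - x) * ((1 - (x ^ 2 + (1 - x) * P')) / (x ^ 2 + (1 - x) * P')) * ((x ^ 2 + (1 - x) * p) * (1 - q)) + x / (1 - x) * ((1 - (q * P' / (P' - p))) / (q * P' / (P' - p))) * ((1 - (x ^ 2 + (1 - x) * p)) * q) + (x ^ 2 + (1 - x) * p) * q := by
  have h1x : 0 < 1 - x := by linarith
  have g1 : 0 ≤ 1 - x := by linarith
  have g2 : 0 ≤ p := hp0.le
  have g3 : 0 ≤ x - p := by linarith
  have g4 : 0 ≤ q - x := by linarith
  have g5 : 0 ≤ 1 - q := by linarith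
  have g6 : 0 ≤ P' - p := by linarith
  have g7 : 0 ≤ x - P' := by linarith
  have g8 : 0 ≤ 3 * x - 1 := by linarith
  have g9 : 0 ≤ (P' - p) - q * P' := by linarith
  have key := tfpPolyF_LH_LH x p q P' g1 g2 g3 g4 g5 g6 g7 g8 g9
  have hd0 : 0 < P' := by linarith
  have hd1 : 0 < x ^ 2 + (1 - x) * P' := add_pos_of_pos_of_nonneg (pow_pos hx0 2) (mul_nonneg h1x.le (by linarith))
  have hne1 : (1:ℝ) - x ≠ 0 := h1x.ne'
  have hPp' : 0 < P' - p := by linarith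
  have hneA : P' - p ≠ 0 := hPp'.ne'
  have hP0 : 0 < P' := by linarith
  have hneP : P' ≠ 0 := hP0.ne'
  have hq0' : 0 < q := by linarith
  have hneq : q ≠ 0 := hq0'.ne'
  have hgP : 0 < x ^ 2 + (1 - x) * P' := add_pos_of_pos_of_nonneg (pow_pos hx0 2) (mul_nonneg h1x.le hP0.le)
  have hnegP : x ^ 2 + (1 - x) * P' ≠ 0 := hgP.ne'
  have hQv0 : 0 < q * P' / (P' - p) := div_pos (mul_pos hq0' hP0) hPp'
  have hneQv : q * P' / (P' - p) ≠ 0 := hQv0.ne'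
  have hneqP : q * P' ≠ 0 := (mul_pos hq0' hP0).ne'
  rw [← sub_nonneg]
  have hden : 0 < (P') * (x ^ 2 + (1 - x) * P') := (mul_pos hd0 hd1)
  have e : (x / (1 - x) * ((1 - (x ^ 2 + (1 - x) * P')) / (x ^ 2 + (1 - x) * P')) * ((x ^ 2 + (1 - x) * p) * (1 - q)) + x / (1 - x) * ((1 - (q * P' / (P' - p))) / (q * P' / (P' - p))) * ((1 - (x ^ 2 + (1 - x) * p)) * q) + (x ^ 2 + (1 - x) * p) * q - x / (1 - x) * ((1 - (x ^ 2 + (1 - x) * p)) * (1 - q))) * ((P') * (x ^ 2 + (1 - x) * P'))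
      = (-x * p * q * P' ^ 2 + x ^ 2 * q * P' ^ 2 + x ^ 2 * p * P' ^ 2 + x ^ 2 * p * q * P' - x ^ 2 * p ^ 2 * P' - x ^ 3 * P' ^ 2 - x ^ 3 * q * P' + x ^ 3 * p ^ 2 + x ^ 4 * P' - x ^ 4 * p + p * q * P' ^ 2 - x * p * P' ^ 2 - x * p * q * P' + x * p ^ 2 * P' + x ^ 3 * P' - x ^ 3 * p) := by
    field_simp
    ring
  rw [eq_div_of_mul_eq hden.ne' e]
  apply div_nonneg _ hden.le
  exact key

set_option maxHeartbeats 4000000 in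
set_option maxRecDepth 100000 in
/-- cell `LH_L1` of the top-flipped light–heavy piece: the capacity inequality with the cell's closed forms. -/
theorem tfpCellF_LH_L1 (x p q P' : ℝ) (hx0 : 0 < x) (hx1 : x < 1) (hp0 : 0 < p) (hpx : p < x) (hxq : x ≤ q) (hq1 : q ≤ 1) (hPp : p < P') (hx3 : (1:ℝ) / 3 ≤ x) (hPx : P' ≤ x) (h1Q : P' - p ≤ q * P') (_hP2 : P' ≤ 2) (_hQ2 : q * P' ≤ 2 * (P' - p)) :
    x / (1 - x) * ((1 - (x ^ 2 + (1 - x) * p)) * (1 - q)) ≤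
      x / (1 - x) * ((1 - (x ^ 2 + (1 - x) * P')) / (x ^ 2 + (1 - x) * P')) * ((x ^ 2 + (1 - x) * p) * (1 - q)) + 0 * ((1 - (x ^ 2 + (1 - x) * p)) * q) + (x ^ 2 + (1 - x) * p) * q := by
  have h1x : 0 < 1 - x := by linarith
  have g1 : 0 ≤ 1 - x := by linarith
  have g2 : 0 ≤ p := hp0.le
  have g3 : 0 ≤ x - p := by linarith
  have g4 : 0 ≤ q - x := by linarith
  have g5 : 0 ≤ 1 - q := by linarith
  have g6 : 0 ≤ P' - p := by linarith
  have g7 : 0 ≤ x - P' := by linarith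
  have g8 : 0 ≤ 3 * x - 1 := by linarith
  have g9 : 0 ≤ q * P' - (P' - p) := by linarith
  have key := tfpPolyF_LH_L1 x p q P' g1 g2 g3 g4 g5 g6 g7 g8 g9
  have hd0 : 0 < x ^ 2 + (1 - x) * P' := add_pos_of_pos_of_nonneg (pow_pos hx0 2) (mul_nonneg h1x.le (by linarith))
  have hne1 : (1:ℝ) - x ≠ 0 := h1x.ne'
  have hPp' : 0 < P' - p := by linarith
  have hneA : P' - p ≠ 0 := hPp'.ne'
  have hP0 : 0 < P' := by linarith
  have hneP : P' ≠ 0 := hP0.ne'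
  have hq0' : 0 < q := by linarith
  have hneq : q ≠ 0 := hq0'.ne'
  have hgP : 0 < x ^ 2 + (1 - x) * P' := add_pos_of_pos_of_nonneg (pow_pos hx0 2) (mul_nonneg h1x.le hP0.le)
  have hnegP : x ^ 2 + (1 - x) * P' ≠ 0 := hgP.ne'
  have hQv0 : 0 < q * P' / (P' - p) := div_pos (mul_pos hq0' hP0) hPp'
  have hneQv : q * P' / (P' - p) ≠ 0 := hQv0.ne'
  have hneqP : q * P' ≠ 0 := (mul_pos hq0' hP0).ne'
  rw [← sub_nonneg]
  have hden : 0 < (x ^ 2 + (1 - x) * P') := hd0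
  have e : (x / (1 - x) * ((1 - (x ^ 2 + (1 - x) * P')) / (x ^ 2 + (1 - x) * P')) * ((x ^ 2 + (1 - x) * p) * (1 - q)) + 0 * ((1 - (x ^ 2 + (1 - x) * p)) * q) + (x ^ 2 + (1 - x) * p) * q - x / (1 - x) * ((1 - (x ^ 2 + (1 - x) * p)) * (1 - q))) * ((x ^ 2 + (1 - x) * P'))
      = (x ^ 2 * p * q * P' - x ^ 3 * q * P' - x ^ 3 * p * q + x ^ 4 * q - 2 * x * p * q * P' + x ^ 2 * q * P' + x ^ 2 * p * q + p * q * P' + x * q * P' - x * p * q - x * P' + x * p) := by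
    field_simp
    ring
  rw [eq_div_of_mul_eq hden.ne' e]
  apply div_nonneg _ hden.le
  exact key

set_option maxHeartbeats 4000000 in
set_option maxRecDepth 100000 in
/-- cell `LH_HH` of the top-flipped light–heavy piece: the capacity inequality with the cell's closed forms. -/
theorem tfpCellF_LH_HH (x p q P' : ℝ) (hx0 : 0 < x) (hx1 : x < 1) (hp0 : 0 < p) (hpx : p < x) (hxq : x ≤ q) (hq1 : q ≤ 1) (hPp : p < P') (_hx3 : (1:ℝ) / 3 ≤ x) (hxP : x ≤ P') (_hP1 : P' < 1) (_hQ1 : q * P' < P' - p) (_hP2 : P' ≤ 2) (_hQ2 : q * P' ≤ 2 * (P' - p)) :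
    x / (1 - x) * ((1 - (x ^ 2 + (1 - x) * p)) * (1 - q)) ≤
      x / (1 - x) * ((1 - P') / P') * ((x ^ 2 + (1 - x) * p) * (1 - q)) + x / (1 - x) * ((1 - (q * P' / (P' - p))) / (q * P' / (P' - p))) * ((1 - (x ^ 2 + (1 - x) * p)) * q) + (x ^ 2 + (1 - x) * p) * q := by
  have h1x : 0 < 1 - x := by linarith
  have g0 : 0 ≤ x := hx0.le
  have g2 : 0 ≤ p := hp0.le
  have g3 : 0 ≤ x - p := by linarith
  have g4 : 0 ≤ q - x := by linarith
  have g5 : 0 ≤ 1 - q := by linarith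
  have g6 : 0 ≤ P' - p := by linarith
  have g7 : 0 ≤ P' - x := by linarith
  have key := tfpPoly_LH_HH x p q P' g0 g2 g3 g4 g5 g6 g7
  have hd0 : 0 < 1 - x := h1x
  have hd1 : 0 < P' := by linarith
  have hne1 : (1:ℝ) - x ≠ 0 := h1x.ne'
  have hPp' : 0 < P' - p := by linarith
  have hneA : P' - p ≠ 0 := hPp'.ne'
  have hP0 : 0 < P' := by linarith
  have hneP : P' ≠ 0 := hP0.ne'
  have hq0' : 0 < q := by linarith
  have hneq : q ≠ 0 := hq0'.ne'
  have hQv0 : 0 < q * P' / (P' - p) := div_pos (mul_pos hq0' hP0) hPp'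
  have hneQv : q * P' / (P' - p) ≠ 0 := hQv0.ne'
  have hneqP : q * P' ≠ 0 := (mul_pos hq0' hP0).ne'
  rw [← sub_nonneg]
  have hden : 0 < (1 - x) * (P') := (mul_pos hd0 hd1)
  have e : (x / (1 - x) * ((1 - P') / P') * ((x ^ 2 + (1 - x) * p) * (1 - q)) + x / (1 - x) * ((1 - (q * P' / (P' - p))) / (q * P' / (P' - p))) * ((1 - (x ^ 2 + (1 - x) * p)) * q) + (x ^ 2 + (1 - x) * p) * q - x / (1 - x) * ((1 - (x ^ 2 + (1 - x) * p)) * (1 - q))) * ((1 - x) * (P'))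
      = (-x * p * q * P' + x ^ 2 * q * P' + x ^ 2 * p * P' + x ^ 2 * p * q - x ^ 2 * p ^ 2 - x ^ 3 * P' - x ^ 3 * q + x ^ 3 * p + p * q * P' - x * p * P' - x * p * q + x * p ^ 2 - x ^ 2 * p + x ^ 3) := by
    field_simp
    ring
  rw [eq_div_of_mul_eq hden.ne' e]
  apply div_nonneg _ hden.le
  exact key

set_option maxHeartbeats 4000000 in
set_option maxRecDepth 100000 in
/-- cell `LH_H1` of the top-flipped light–heavy piece: the capacity inequality with the cell's closed forms. -/
theorem tfpCellF_LH_H1 (x p q P' : ℝ) (hx0 : 0 < x) (hx1 : x < 1) (hp0 : 0 < p) (hpx : p < x) (hxq : x ≤ q) (_hq1 : q ≤ 1) (hPp : p < P') (_hx3 : (1:ℝ) / 3 ≤ x) (hxP : x ≤ P') (_hP1 : P' < 1) (h1Q : P' - p ≤ q * P') (_hP2 : P' ≤ 2) (_hQ2 : q * P' ≤ 2 * (P' - p)) :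
    x / (1 - x) * ((1 - (x ^ 2 + (1 - x) * p)) * (1 - q)) ≤
      x / (1 - x) * ((1 - P') / P') * ((x ^ 2 + (1 - x) * p) * (1 - q)) + 0 * ((1 - (x ^ 2 + (1 - x) * p)) * q) + (x ^ 2 + (1 - x) * p) * q := by
  have h1x : 0 < 1 - x := by linarith
  have g0 : 0 ≤ x := hx0.le
  have g1 : 0 ≤ 1 - x := by linarith
  have g2 : 0 ≤ p := hp0.le
  have g3 : 0 ≤ x - p := by linarith
  have g4 : 0 ≤ q - x := by linarith
  have g7 : 0 ≤ P' - x := by linarith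
  have g9 : 0 ≤ q * P' - (P' - p) := by linarith
  have key := tfpPoly_LH_H1 x p q P' g0 g1 g2 g3 g4 g7 g9
  have hd0 : 0 < 1 - x := h1x
  have hd1 : 0 < P' := by linarith
  have hne1 : (1:ℝ) - x ≠ 0 := h1x.ne'
  have hPp' : 0 < P' - p := by linarith
  have hneA : P' - p ≠ 0 := hPp'.ne'
  have hP0 : 0 < P' := by linarith
  have hneP : P' ≠ 0 := hP0.ne'
  have hq0' : 0 < q := by linarith
  have hneq : q ≠ 0 := hq0'.ne'
  have hQv0 : 0 < q * P' / (P' - p) := div_pos (mul_pos hq0' hP0) hPp'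
  have hneQv : q * P' / (P' - p) ≠ 0 := hQv0.ne'
  have hneqP : q * P' ≠ 0 := (mul_pos hq0' hP0).ne'
  rw [← sub_nonneg]
  have hden : 0 < (1 - x) * (P') := (mul_pos hd0 hd1)
  have e : (x / (1 - x) * ((1 - P') / P') * ((x ^ 2 + (1 - x) * p) * (1 - q)) + 0 * ((1 - (x ^ 2 + (1 - x) * p)) * q) + (x ^ 2 + (1 - x) * p) * q - x / (1 - x) * ((1 - (x ^ 2 + (1 - x) * p)) * (1 - q))) * ((1 - x) * (P'))
      = (x ^ 2 * p * q * P' - x ^ 3 * q * P' - 2 * x * p * q * P' + x ^ 2 * q * P' + x ^ 2 * p * q - x ^ 3 * q + p * q * P' + x * q * P' - x * p * q - x ^ 2 * p + x ^ 3 - x * P' + x * p) := by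
    field_simp
    ring
  rw [eq_div_of_mul_eq hden.ne' e]
  apply div_nonneg _ hden.le
  exact key

set_option maxHeartbeats 4000000 in
set_option maxRecDepth 100000 in
/-- cell `LH_1H` of the top-flipped light–heavy piece: the capacity inequality with the cell's closed forms. -/
theorem tfpCellF_LH_1H (x p q Q' : ℝ) (hx0 : 0 < x) (_hx1 : x < 1) (hp0 : 0 < p) (hpx : p < x) (hxq : x ≤ q) (_hq1 : q ≤ 1) (hQq : q < Q') (hPge1 : Q' * (1 - p) ≤ q) (_hx3 : (1:ℝ) / 3 ≤ x) (_hxQ : x ≤ Q') (hQ1 : Q' < 1) (_hQ2 : Q' ≤ 2) :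
    x / (1 - x) * ((1 - (x ^ 2 + (1 - x) * p)) * (1 - q)) ≤
      0 * ((x ^ 2 + (1 - x) * p) * (1 - q)) + x / (1 - x) * ((1 - Q') / Q') * ((1 - (x ^ 2 + (1 - x) * p)) * q) + (x ^ 2 + (1 - x) * p) * q := by
  have h1x : 0 < 1 - x := by linarith
  have g0 : 0 ≤ x := hx0.le
  have g1 : 0 ≤ 1 - x := by linarith
  have g2 : 0 ≤ p := hp0.le
  have g3 : 0 ≤ x - p := by linarith
  have g4 : 0 ≤ q - x := by linarith
  have g7 : 0 ≤ q - Q' * (1 - p) := by linarith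
  have g8 : 0 ≤ Q' - x := by linarith
  have key := tfpPoly_LH_1H x p q Q' g0 g1 g2 g3 g4 g7 g8
  have hd0 : 0 < Q' := by linarith
  have hne1 : (1:ℝ) - x ≠ 0 := h1x.ne'
  have hQ0 : 0 < Q' := by linarith
  have hneQ : Q' ≠ 0 := hQ0.ne'
  rw [← sub_nonneg]
  have hden : 0 < (Q') := hd0
  have e : (0 * ((x ^ 2 + (1 - x) * p) * (1 - q)) + x / (1 - x) * ((1 - Q') / Q') * ((1 - (x ^ 2 + (1 - x) * p)) * q) + (x ^ 2 + (1 - x) * p) * q - x / (1 - x) * ((1 - (x ^ 2 + (1 - x) * p)) * (1 - q))) * ((Q'))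
      = (-x * p * q * Q' + x ^ 2 * q * Q' + p * q * Q' + x * p * Q' - x * p * q - x ^ 2 * Q' + x ^ 2 * q - x * Q' + x * q) := by
    field_simp
    ring
  rw [eq_div_of_mul_eq hden.ne' e]
  apply div_nonneg _ hden.le
  exact key

set_option maxHeartbeats 4000000 in
set_option maxRecDepth 100000 in
/-- cell `LH_11` of the top-flipped light–heavy piece: the capacity inequality with the cell's closed forms. -/
theorem tfpCellF_LH_11 (x p q Q' : ℝ) (hx0 : 0 < x) (hx1 : x < 1) (hp0 : 0 < p) (hpx : p < x) (hxq : x ≤ q) (_hq1 : q ≤ 1) (hQq : q < Q') (hPge1 : Q' * (1 - p) ≤ q) (_hx3 : (1:ℝ) / 3 ≤ x) (h1Q : 1 ≤ Q') (_hQ2 : Q' ≤ 2) :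
    x / (1 - x) * ((1 - (x ^ 2 + (1 - x) * p)) * (1 - q)) ≤
      0 * ((x ^ 2 + (1 - x) * p) * (1 - q)) + 0 * ((1 - (x ^ 2 + (1 - x) * p)) * q) + (x ^ 2 + (1 - x) * p) * q := by
  have h1x : 0 < 1 - x := by linarith
  have g0 : 0 ≤ x := hx0.le
  have g1 : 0 ≤ 1 - x := by linarith
  have g2 : 0 ≤ p := hp0.le
  have g3 : 0 ≤ x - p := by linarith
  have g4 : 0 ≤ q - x := by linarith
  have g7 : 0 ≤ q - Q' * (1 - p) := by linarith
  have g8 : 0 ≤ Q' - 1 := by linarith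
  have key := tfpPoly_LH_11 x p q Q' g0 g1 g2 g3 g4 g7 g8
  have hne1 : (1:ℝ) - x ≠ 0 := h1x.ne'
  have hQ0 : 0 < Q' := by linarith
  have hneQ : Q' ≠ 0 := hQ0.ne'
  rw [← sub_nonneg]
  have e : 0 * ((x ^ 2 + (1 - x) * p) * (1 - q)) + 0 * ((1 - (x ^ 2 + (1 - x) * p)) * q) + (x ^ 2 + (1 - x) * p) * q - x / (1 - x) * ((1 - (x ^ 2 + (1 - x) * p)) * (1 - q))
      = (-2 * x * p * q + 2 * x ^ 2 * q + p * q + x * q + x * p - x ^ 2 - x) := by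
    field_simp
    ring
  rw [e]
  exact key

end LawDec

end Quant

end Summit.CriticalPhenomena.PercolationContinuityZ3.Theorems
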